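import Summits.Ventures.Crystal3D.Theorems.StickyWulffConstantGenericWallFloorBarlowRowOrientedGlueApart
import Summits.Ventures.Crystal3D.Theorems.StickyWulffConstantGenericWallFloorBarlowRowRowLineCountMApart
import Summits.Ventures.Crystal3D.Theorems.StickyWulffConstantGenericWallFloorBarlowZigZigOrientedGlue36Apart
import Summits.Ventures.Crystal3D.Theorems.StickyWulffConstantGenericWallFloorBarlowRowCovGlue
import Summits.Ventures.Crystal3D.Theorems.StickyWulffConstantGenericWallFloorBarlowCoverableGlueApart
import HarnessLib

/-!
# Lane T's v3 `hlines` for `OffR := FramesApart` (option (C), the stub closer of record): `barlow_rowhlines_apart`,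
# `bilayerWallRowCovFrom_framesApart : BilayerWallRowCovFrom FramesApart 6`
# (crux `GenericWallFloor`, stmt-Ventures-19480, line `WallLedgerG`; closes lane T's `stub_bilayerWallRowCov : ∃ R, BilayerWallRowCovFrom
# FramesApart R` (TexShadow v6.13) by `⟨6, bilayerWallRowCovFrom_framesApart hsE hcert hDS hCP⟩`, modulo E1 / `StarPairFar` as hypotheses)

HONEST FRAMING. Venture `Summits/Ventures/Crystal3D` (cell `crystal3d-full`), helper `--supports` the crux `GenericWallFloor`
(stmt-Ventures-19480) of `route-Ventures-StickyWulffConstant`, registered line `WallLedgerG`, open stub `stub_twoSlabAdhesion`.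
Rung credit only; F-C1 not moved; NOT the stub of this crux.  Inputs BY NAME: E1 (`hsE`, `hcert`), `DoubleStarCoaxialAt` /
`CapPairCoaxial` (`hDS`, `hCP`, from `StarPairFar`).

Verbatim `barlow_rowhlines` (`…BarlowRowCovGlue`, OffR := `BarlowPairOffReach`) with the positional pair hypothesis replaced by the
translation-free `FramesApart L₁ s₁ σ₁ L₂ s₂ σ₂` (`…TexShadowCornerFramesDefs`, cf-p1 DECISION (xxxvii⁵)): its three clauses are
unfolded per corner by `corner_of_zigGood` / `corner_of_not_zigGood` (corner frame SETS instead of reach sets) and fed to the `…Apart`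
corners `barlow_hlines_oriented36_apart`, `barlow_rowZig_hlines_oriented_apart`, `barlow_zigRow_hlines_oriented_apart`,
`barlow_rowRow_hlines_apart` (core avoidance `…BarlowCoreAvoid` + frame-separated ledger `…WalkerFamilyLedgerSep` underneath); for an
UP-PRESENTED zig plate the lattice pair `{L·Λ₀, (twinFrame L (L e₃))·Λ₀}` is that of the presentation frame `upFrame L z`
(`apart_upFrame`).  The weight-`0` providers `exists_selector_lineSets` / `exists_rowSets` are reused from `…BarlowRowCovGlue`.
(`apart_upFrame`, `…BarlowCoverableGlueApart`: the two presentations have the same lattice pair.)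
* **`barlow_rowhlines_apart`** — lane T's `hlines` VERBATIM for `OffR := FramesApart`, `C_w = 540 + 384 R₀`, `R₀ ≥ 6`.
* **`bilayerWallRowCovFrom_framesApart`** : `BilayerWallRowCovFrom FramesApart 6`; `exists_bilayerWallRowCovFrom_framesApart` : the
  stub's literal statement `∃ R, BilayerWallRowCovFrom FramesApart R` (both modulo E1 / `StarPairFar` as hypotheses).
WHAT THIS IS NOT: E1 (`P5Exhaustion`) is lane T's `stub_E1`; F-C1 not moved.
-/

noncomputable section

namespace Summit.Ventures.Crystal3D.Theorems

open Finset
open Literature.MathematicalPhysics.StatisticalMechanics (barlowPos barlowStacking barlowLayer basalMirror haggLabel barlowOffset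
  IsHaggSeq triangularVec₁ triangularVec₂ fccStacking)
open Summit.Ventures.Crystal3D.Cruxes.TextureLiminf.TexShadow (stacking cyl upSlot₁ upSlot₂ upSlot₃ bilayerRise upFrame upWord famSlot
  DeltaSteep ZigGood zigW rowW IsCLayer FramesApart BilayerWallRowCovFrom bestLayerDir layerRise RowSteep stacking_upFrame
  upFrame_axis_nonneg isHaggSeq_upWord famSlot_steep_of_deltaSteep corner_of_zigGood corner_of_not_zigGood framesApart_sep
  rowSteep_of_not_zigGood inner_bestLayerDir)
open scoped InnerProductSpace

open scoped Classical in
/-- **Lane T's v3 `hlines` for `OffR := FramesApart`** (the stub closer of record).  See the module docstring. -/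
theorem barlow_rowhlines_apart
    {sE : EuclideanSpace ℝ (Fin 3)} (hsE : sE ∈ fccSlots) (hcert : ExactOnly 0 (fccSlots.filter fun w => 0 < ⟪w, sE⟫_ℝ))
    (hDS : ∀ F₁ F₂ : EuclideanSpace ℝ (Fin 3) ≃ₗᵢ[ℝ] EuclideanSpace ℝ (Fin 3), DoubleStarCoaxialAt F₁ F₂) (hCP : CapPairCoaxial)
    (R₀ : ℝ) (hR₀ : 6 ≤ R₀) {σ₁ σ₂ : ℤ → ℤ} (hσ₁ : IsHaggSeq σ₁) (hσ₂ : IsHaggSeq σ₂)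
    (L₁ L₂ : EuclideanSpace ℝ (Fin 3) ≃ₗᵢ[ℝ] EuclideanSpace ℝ (Fin 3)) (s₁ s₂ : EuclideanSpace ℝ (Fin 3))
    (hoff : FramesApart L₁ s₁ σ₁ L₂ s₂ σ₂) :
    ∃ step₁ step₂ : ℤ → EuclideanSpace ℝ (Fin 3),
      IsZigSelector L₁ σ₁ (EuclideanSpace.single (2 : Fin 3) (1 : ℝ)) step₁ ∧
      IsZigSelector L₂ σ₂ (-EuclideanSpace.single (2 : Fin 3) (1 : ℝ)) step₂ ∧
      ∀ h : ℝ, 0 ≤ h → ∀ ρ : ℝ, R₀ ≤ ρ → ∀ X P₁ P₂ : Finset (EuclideanSpace ℝ (Fin 3)),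
      (∀ p ∈ X, ∀ q ∈ X, p ≠ q → 1 ≤ dist p q) → P₁ ⊆ X → P₂ ⊆ X \ P₁ → (∀ p ∈ X, p ∈ cyl R₀ h ρ) →
      (∀ p, p ∈ P₁ ↔ (p ∈ stacking L₁ s₁ σ₁ ∧ -(2 * R₀) ≤ p 2 ∧ p 2 ≤ -R₀ ∧ p 0 ^ 2 + p 1 ^ 2 ≤ ρ ^ 2)) →
      (∀ p, p ∈ P₂ ↔ (p ∈ stacking L₂ s₂ σ₂ ∧ h + R₀ ≤ p 2 ∧ p 2 ≤ h + 2 * R₀ ∧ p 0 ^ 2 + p 1 ^ 2 ≤ ρ ^ 2)) →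
      ∃ (m : ℝ) (T₁ T₂ : Finset (Fin 2 → ℤ)) (T₃ T₄ : Finset (ℤ × ℤ)), 0 ≤ m ∧
        (∀ t : Fin 2 → ℤ, (∃ k : ℤ,
          -R₀ - 4 ≤ (L₁ (zigVertexS step₁ k + ((t 0 : ℝ) • triangularVec₁ 1 + (t 1 : ℝ) • triangularVec₂ 1)) + s₁) 2 ∧
          (L₁ (zigVertexS step₁ k + ((t 0 : ℝ) • triangularVec₁ 1 + (t 1 : ℝ) • triangularVec₂ 1)) + s₁) 2 ≤ -R₀ - 3 ∧
          Real.sqrt ((L₁ (zigVertexS step₁ k + ((t 0 : ℝ) • triangularVec₁ 1 + (t 1 : ℝ) • triangularVec₂ 1)) + s₁) 0 ^ 2 +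
            (L₁ (zigVertexS step₁ k + ((t 0 : ℝ) • triangularVec₁ 1 + (t 1 : ℝ) • triangularVec₂ 1)) + s₁) 1 ^ 2) ≤ ρ - m) →
          t ∈ T₁) ∧
        (∀ t : Fin 2 → ℤ, (∃ k : ℤ,
          h + R₀ + 3 ≤ (L₂ (zigVertexS step₂ k + ((t 0 : ℝ) • triangularVec₁ 1 + (t 1 : ℝ) • triangularVec₂ 1)) + s₂) 2 ∧
          (L₂ (zigVertexS step₂ k + ((t 0 : ℝ) • triangularVec₁ 1 + (t 1 : ℝ) • triangularVec₂ 1)) + s₂) 2 ≤ h + R₀ + 4 ∧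
          Real.sqrt ((L₂ (zigVertexS step₂ k + ((t 0 : ℝ) • triangularVec₁ 1 + (t 1 : ℝ) • triangularVec₂ 1)) + s₂) 0 ^ 2 +
            (L₂ (zigVertexS step₂ k + ((t 0 : ℝ) • triangularVec₁ 1 + (t 1 : ℝ) • triangularVec₂ 1)) + s₂) 1 ^ 2) ≤ ρ - m) →
          t ∈ T₂) ∧
        (∀ kj : ℤ × ℤ, IsCLayer σ₁ kj.1 → (∃ i : ℤ,
          -R₀ - 4 ≤ (L₁ (layerSite σ₁ L₁ (EuclideanSpace.single (2 : Fin 3) (1 : ℝ)) kj.1 i kj.2) + s₁) 2 ∧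
          (L₁ (layerSite σ₁ L₁ (EuclideanSpace.single (2 : Fin 3) (1 : ℝ)) kj.1 i kj.2) + s₁) 2 ≤ -R₀ - 3 ∧
          Real.sqrt ((L₁ (layerSite σ₁ L₁ (EuclideanSpace.single (2 : Fin 3) (1 : ℝ)) kj.1 i kj.2) + s₁) 0 ^ 2 +
            (L₁ (layerSite σ₁ L₁ (EuclideanSpace.single (2 : Fin 3) (1 : ℝ)) kj.1 i kj.2) + s₁) 1 ^ 2) ≤ ρ - m) → kj ∈ T₃) ∧
        (∀ kj : ℤ × ℤ, IsCLayer σ₂ kj.1 → (∃ i : ℤ,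
          h + R₀ + 3 ≤ (L₂ (layerSite σ₂ L₂ (-EuclideanSpace.single (2 : Fin 3) (1 : ℝ)) kj.1 i kj.2) + s₂) 2 ∧
          (L₂ (layerSite σ₂ L₂ (-EuclideanSpace.single (2 : Fin 3) (1 : ℝ)) kj.1 i kj.2) + s₂) 2 ≤ h + R₀ + 4 ∧
          Real.sqrt ((L₂ (layerSite σ₂ L₂ (-EuclideanSpace.single (2 : Fin 3) (1 : ℝ)) kj.1 i kj.2) + s₂) 0 ^ 2 +
            (L₂ (layerSite σ₂ L₂ (-EuclideanSpace.single (2 : Fin 3) (1 : ℝ)) kj.1 i kj.2) + s₂) 1 ^ 2) ≤ ρ - m) → kj ∈ T₄) ∧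
        zigW L₁ σ₁ (EuclideanSpace.single (2 : Fin 3) (1 : ℝ)) * (T₁.card : ℝ) +
            zigW L₂ σ₂ (-EuclideanSpace.single (2 : Fin 3) (1 : ℝ)) * T₂.card +
            rowW L₁ σ₁ (EuclideanSpace.single (2 : Fin 3) (1 : ℝ)) * T₃.card +
            rowW L₂ σ₂ (-EuclideanSpace.single (2 : Fin 3) (1 : ℝ)) * T₄.card + 36 * m * ρ ≤
          (∑ y ∈ X.filter (fun y => (X.filter fun q => dist y q = 1).card ≠ 12 ∧ -R₀ - 2 ≤ y 2 ∧ y 2 ≤ h + R₀ + 2),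
            ((12 : ℝ) - ((X.filter fun q => dist y q = 1).card : ℝ))) + (540 + 384 * R₀) * (1 + h) * ρ := by
  set e₃ : EuclideanSpace ℝ (Fin 3) := EuclideanSpace.single (2 : Fin 3) (1 : ℝ) with he₃
  have he₃n : ‖e₃‖ = 1 := by rw [he₃, PiLp.norm_single, norm_one]
  have hztn : ‖-e₃‖ = 1 := by rw [norm_neg, he₃n]
  have he₃' : Summit.Ventures.Crystal3D.Cruxes.TextureLiminf.TexShadow.e₃ = e₃ := rfl
  -- the two up-presentations (used by the zig families)
  obtain ⟨hσ₁', hax₁, hst₁, htr₁⟩ := exists_upPresentation L₁ hσ₁ s₁ e₃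
  obtain ⟨hσ₂', hax₂, hst₂, htr₂⟩ := exists_upPresentation L₂ hσ₂ s₂ (-e₃)
  set L₁' := upFrame L₁ e₃ with hL₁'
  set L₂' := upFrame L₂ (-e₃) with hL₂'
  set σ₁' := upWord L₁ σ₁ e₃ with hσ₁'def
  set σ₂' := upWord L₂ σ₂ (-e₃) with hσ₂'def
  have hfam₁ : famSlot L₁ e₃ = best3 (fun w => ⟪w, L₁'.symm e₃⟫_ℝ) upSlot₁ upSlot₂ upSlot₃ := rfl
  have hfam₂ : famSlot L₂ (-e₃) = best3 (fun w => ⟪w, L₂'.symm (-e₃)⟫_ℝ) upSlot₁ upSlot₂ upSlot₃ := rfl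
  -- weight-0 providers
  obtain ⟨stepZ₁, hselZ₁, hlinesZ₁⟩ := exists_selector_lineSets L₁ hσ₁ s₁ e₃
  obtain ⟨stepZ₂, hselZ₂, hlinesZ₂⟩ := exists_selector_lineSets L₂ hσ₂ s₂ (-e₃)
  -- row steepness from ¬ZigGood
  have hrow_of : ∀ (L : EuclideanSpace ℝ (Fin 3) ≃ₗᵢ[ℝ] EuclideanSpace ℝ (Fin 3)) (σ : ℤ → ℤ) (z : EuclideanSpace ℝ (Fin 3)),
      ‖z‖ = 1 → ¬ ZigGood L σ z → Real.sqrt 2 / 2 ≤ ⟪L (bestLayerDir L z), z⟫_ℝ := by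
    intro L σ z hz h
    have hRS : RowSteep L z := rowSteep_of_not_zigGood hz h
    rw [inner_map_eq_inner_symm, inner_bestLayerDir]; exact hRS
  have hO3 := framesApart_sep hoff
  obtain ⟨hO1, hO2, -⟩ := hoff
  rw [he₃'] at hO1 hO2 hO3
  -- generic ⊇ proofs for weight-0 families, per cell
  have rowSup₁ : ∀ (h ρ m : ℝ) (X P₁ : Finset (EuclideanSpace ℝ (Fin 3))), 0 ≤ m → R₀ ≤ ρ →
      (∀ p, p ∈ P₁ ↔ (p ∈ stacking L₁ s₁ σ₁ ∧ -(2 * R₀) ≤ p 2 ∧ p 2 ≤ -R₀ ∧ p 0 ^ 2 + p 1 ^ 2 ≤ ρ ^ 2)) →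
      ∃ T₃ : Finset (ℤ × ℤ), ∀ kj : ℤ × ℤ, IsCLayer σ₁ kj.1 → (∃ i : ℤ,
          -R₀ - 4 ≤ (L₁ (layerSite σ₁ L₁ e₃ kj.1 i kj.2) + s₁) 2 ∧ (L₁ (layerSite σ₁ L₁ e₃ kj.1 i kj.2) + s₁) 2 ≤ -R₀ - 3 ∧
          Real.sqrt ((L₁ (layerSite σ₁ L₁ e₃ kj.1 i kj.2) + s₁) 0 ^ 2 + (L₁ (layerSite σ₁ L₁ e₃ kj.1 i kj.2) + s₁) 1 ^ 2) ≤ ρ - m) →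
        kj ∈ T₃ := by
    intro h ρ m X P₁ hm0 hρ hP₁
    obtain ⟨Tr, hTr⟩ := exists_rowSets σ₁ L₁ s₁ e₃ P₁ (fun q hq => ((hP₁ q).1 hq).1)
    refine ⟨Tr, fun kj _ ⟨i, h1, h2, h3⟩ => hTr kj ⟨i, (hP₁ _).2 ⟨layerSite_mem_stacking σ₁ L₁ e₃ s₁ kj.1 i kj.2,
      by linarith only [h1, hR₀], by linarith only [h2], ?_⟩⟩⟩
    have h0 : 0 ≤ (L₁ (layerSite σ₁ L₁ e₃ kj.1 i kj.2) + s₁) 0 ^ 2 + (L₁ (layerSite σ₁ L₁ e₃ kj.1 i kj.2) + s₁) 1 ^ 2 := by positivity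
    have hle : Real.sqrt ((L₁ (layerSite σ₁ L₁ e₃ kj.1 i kj.2) + s₁) 0 ^ 2 + (L₁ (layerSite σ₁ L₁ e₃ kj.1 i kj.2) + s₁) 1 ^ 2) ≤ ρ := by
      linarith only [h3, hm0]
    have h7 := pow_le_pow_left₀ (Real.sqrt_nonneg _) hle 2
    rwa [Real.sq_sqrt h0] at h7
  have rowSup₂ : ∀ (h ρ m : ℝ) (X P₂ : Finset (EuclideanSpace ℝ (Fin 3))), 0 ≤ m → R₀ ≤ ρ →
      (∀ p, p ∈ P₂ ↔ (p ∈ stacking L₂ s₂ σ₂ ∧ h + R₀ ≤ p 2 ∧ p 2 ≤ h + 2 * R₀ ∧ p 0 ^ 2 + p 1 ^ 2 ≤ ρ ^ 2)) →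
      ∃ T₄ : Finset (ℤ × ℤ), ∀ kj : ℤ × ℤ, IsCLayer σ₂ kj.1 → (∃ i : ℤ,
          h + R₀ + 3 ≤ (L₂ (layerSite σ₂ L₂ (-e₃) kj.1 i kj.2) + s₂) 2 ∧ (L₂ (layerSite σ₂ L₂ (-e₃) kj.1 i kj.2) + s₂) 2 ≤ h + R₀ + 4 ∧
          Real.sqrt ((L₂ (layerSite σ₂ L₂ (-e₃) kj.1 i kj.2) + s₂) 0 ^ 2 + (L₂ (layerSite σ₂ L₂ (-e₃) kj.1 i kj.2) + s₂) 1 ^ 2) ≤ ρ - m) →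
        kj ∈ T₄ := by
    intro h ρ m X P₂ hm0 hρ hP₂
    obtain ⟨Tr, hTr⟩ := exists_rowSets σ₂ L₂ s₂ (-e₃) P₂ (fun q hq => ((hP₂ q).1 hq).1)
    refine ⟨Tr, fun kj _ ⟨i, h1, h2, h3⟩ => hTr kj ⟨i, (hP₂ _).2 ⟨layerSite_mem_stacking σ₂ L₂ (-e₃) s₂ kj.1 i kj.2,
      by linarith only [h1], by linarith only [h2, hR₀], ?_⟩⟩⟩
    have h0 : 0 ≤ (L₂ (layerSite σ₂ L₂ (-e₃) kj.1 i kj.2) + s₂) 0 ^ 2 + (L₂ (layerSite σ₂ L₂ (-e₃) kj.1 i kj.2) + s₂) 1 ^ 2 := by positivity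
    have hle : Real.sqrt ((L₂ (layerSite σ₂ L₂ (-e₃) kj.1 i kj.2) + s₂) 0 ^ 2 + (L₂ (layerSite σ₂ L₂ (-e₃) kj.1 i kj.2) + s₂) 1 ^ 2) ≤ ρ := by
      linarith only [h3, hm0]
    have h7 := pow_le_pow_left₀ (Real.sqrt_nonneg _) hle 2
    rwa [Real.sq_sqrt h0] at h7
  have zigSup₁ : ∀ (h ρ m : ℝ) (X P₁ : Finset (EuclideanSpace ℝ (Fin 3))), 0 ≤ m → R₀ ≤ ρ →
      (∀ p, p ∈ P₁ ↔ (p ∈ stacking L₁ s₁ σ₁ ∧ -(2 * R₀) ≤ p 2 ∧ p 2 ≤ -R₀ ∧ p 0 ^ 2 + p 1 ^ 2 ≤ ρ ^ 2)) →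
      ∃ T₁ : Finset (Fin 2 → ℤ), ∀ t : Fin 2 → ℤ, (∃ k : ℤ,
          -R₀ - 4 ≤ (L₁ (zigVertexS stepZ₁ k + ((t 0 : ℝ) • triangularVec₁ 1 + (t 1 : ℝ) • triangularVec₂ 1)) + s₁) 2 ∧
          (L₁ (zigVertexS stepZ₁ k + ((t 0 : ℝ) • triangularVec₁ 1 + (t 1 : ℝ) • triangularVec₂ 1)) + s₁) 2 ≤ -R₀ - 3 ∧
          Real.sqrt ((L₁ (zigVertexS stepZ₁ k + ((t 0 : ℝ) • triangularVec₁ 1 + (t 1 : ℝ) • triangularVec₂ 1)) + s₁) 0 ^ 2 +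
            (L₁ (zigVertexS stepZ₁ k + ((t 0 : ℝ) • triangularVec₁ 1 + (t 1 : ℝ) • triangularVec₂ 1)) + s₁) 1 ^ 2) ≤ ρ - m) → t ∈ T₁ := by
    intro h ρ m X P₁ hm0 hρ hP₁
    obtain ⟨Tl, hTl⟩ := hlinesZ₁ P₁ (fun q hq => ((hP₁ q).1 hq).1)
    refine ⟨Tl, fun t ⟨k, h1, h2, h3⟩ => hTl t ⟨k, (hP₁ _).2 ⟨?_, by linarith only [h1, hR₀], by linarith only [h2], ?_⟩⟩⟩
    · exact selector_point_mem_stacking L₁ hσ₁ s₁ e₃ hselZ₁ k t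
    · set q := L₁ (zigVertexS stepZ₁ k + ((t 0 : ℝ) • triangularVec₁ 1 + (t 1 : ℝ) • triangularVec₂ 1)) + s₁
      have h0 : 0 ≤ q 0 ^ 2 + q 1 ^ 2 := by positivity
      have hle : Real.sqrt (q 0 ^ 2 + q 1 ^ 2) ≤ ρ := by linarith only [h3, hm0]
      have h7 := pow_le_pow_left₀ (Real.sqrt_nonneg _) hle 2
      rwa [Real.sq_sqrt h0] at h7
  have zigSup₂ : ∀ (h ρ m : ℝ) (X P₂ : Finset (EuclideanSpace ℝ (Fin 3))), 0 ≤ m → R₀ ≤ ρ →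
      (∀ p, p ∈ P₂ ↔ (p ∈ stacking L₂ s₂ σ₂ ∧ h + R₀ ≤ p 2 ∧ p 2 ≤ h + 2 * R₀ ∧ p 0 ^ 2 + p 1 ^ 2 ≤ ρ ^ 2)) →
      ∃ T₂ : Finset (Fin 2 → ℤ), ∀ t : Fin 2 → ℤ, (∃ k : ℤ,
          h + R₀ + 3 ≤ (L₂ (zigVertexS stepZ₂ k + ((t 0 : ℝ) • triangularVec₁ 1 + (t 1 : ℝ) • triangularVec₂ 1)) + s₂) 2 ∧
          (L₂ (zigVertexS stepZ₂ k + ((t 0 : ℝ) • triangularVec₁ 1 + (t 1 : ℝ) • triangularVec₂ 1)) + s₂) 2 ≤ h + R₀ + 4 ∧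
          Real.sqrt ((L₂ (zigVertexS stepZ₂ k + ((t 0 : ℝ) • triangularVec₁ 1 + (t 1 : ℝ) • triangularVec₂ 1)) + s₂) 0 ^ 2 +
            (L₂ (zigVertexS stepZ₂ k + ((t 0 : ℝ) • triangularVec₁ 1 + (t 1 : ℝ) • triangularVec₂ 1)) + s₂) 1 ^ 2) ≤ ρ - m) → t ∈ T₂ := by
    intro h ρ m X P₂ hm0 hρ hP₂
    obtain ⟨Tl, hTl⟩ := hlinesZ₂ P₂ (fun q hq => ((hP₂ q).1 hq).1)
    refine ⟨Tl, fun t ⟨k, h1, h2, h3⟩ => hTl t ⟨k, (hP₂ _).2 ⟨?_, by linarith only [h1], by linarith only [h2, hR₀], ?_⟩⟩⟩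
    · exact selector_point_mem_stacking L₂ hσ₂ s₂ (-e₃) hselZ₂ k t
    · set q := L₂ (zigVertexS stepZ₂ k + ((t 0 : ℝ) • triangularVec₁ 1 + (t 1 : ℝ) • triangularVec₂ 1)) + s₂
      have h0 : 0 ≤ q 0 ^ 2 + q 1 ^ 2 := by positivity
      have hle : Real.sqrt (q 0 ^ 2 + q 1 ^ 2) ≤ ρ := by linarith only [h3, hm0]
      have h7 := pow_le_pow_left₀ (Real.sqrt_nonneg _) hle 2
      rwa [Real.sq_sqrt h0] at h7
  by_cases hZ₁ : ZigGood L₁ σ₁ e₃ <;> by_cases hZ₂ : ZigGood L₂ σ₂ (-e₃)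
  · -- ZIG | ZIG
    rw [(corner_of_zigGood hZ₁ s₁).2.2.1] at hO1 hO3
    rw [(corner_of_zigGood hZ₂ s₂).2.2.1] at hO2 hO3
    rw [hfam₁] at hO1 hO3; rw [hfam₂] at hO2 hO3
    have hst1 := famSlot_steep_of_deltaSteep L₁ e₃ hZ₁.1
    have hst2 := famSlot_steep_of_deltaSteep L₂ (-e₃) hZ₂.1
    rw [hfam₁] at hst1; rw [hfam₂] at hst2
    obtain ⟨step₁', step₂', hsel₁', hsel₂', hmain⟩ := barlow_hlines_oriented36_apart hsE hcert hDS hCP hσ₁' hσ₂' L₁' L₂' s₁ s₂ hax₁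
      hax₂ hst1 hst2 (fun F hF => apart_upFrame L₂ (-e₃) (hO1 F hF)) (fun F hF => apart_upFrame L₁ e₃ (hO2 F hF)) hO3 R₀ hR₀
    obtain ⟨step₁, hsel₁, hpt₁⟩ := htr₁ step₁' hsel₁'
    obtain ⟨step₂, hsel₂, hpt₂⟩ := htr₂ step₂' hsel₂'
    refine ⟨step₁, step₂, hsel₁, hsel₂, ?_⟩
    intro h hh ρ hρ X P₁ P₂ hX hP₁X hP₂X hcyl hP₁ hP₂
    have hP₁' : ∀ p, p ∈ P₁ ↔ (p ∈ stacking L₁' s₁ σ₁' ∧ -(2 * R₀) ≤ p 2 ∧ p 2 ≤ -R₀ ∧ p 0 ^ 2 + p 1 ^ 2 ≤ ρ ^ 2) := by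
      intro p; rw [hst₁]; exact hP₁ p
    have hP₂' : ∀ p, p ∈ P₂ ↔ (p ∈ stacking L₂' s₂ σ₂' ∧ h + R₀ ≤ p 2 ∧ p 2 ≤ h + 2 * R₀ ∧ p 0 ^ 2 + p 1 ^ 2 ≤ ρ ^ 2) := by
      intro p; rw [hst₂]; exact hP₂ p
    obtain ⟨m, T₁, T₂, hm0, hT₁, hT₂, hcount⟩ := hmain h hh ρ hρ X P₁ P₂ hX hP₁X hP₂X hcyl hP₁' hP₂'
    obtain ⟨T₃, hT₃⟩ := rowSup₁ h ρ m X P₁ hm0 hρ hP₁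
    obtain ⟨T₄, hT₄⟩ := rowSup₂ h ρ m X P₂ hm0 hρ hP₂
    refine ⟨m, T₁, T₂, T₃, T₄, hm0, fun t ⟨k, hk⟩ => hT₁ t ⟨k, ?_⟩, fun t ⟨k, hk⟩ => hT₂ t ⟨k, ?_⟩, hT₃, hT₄, ?_⟩
    · rw [← hpt₁ k t]; exact hk
    · rw [← hpt₂ k t]; exact hk
    · simp only [zigW, rowW, if_pos hZ₁, if_pos hZ₂]
      have h0 : (0 : ℝ) ≤ T₃.card := Nat.cast_nonneg _
      linarith
  · -- ZIG | ROW
    rw [(corner_of_zigGood hZ₁ s₁).2.2.1] at hO1 hO3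
    rw [(corner_of_not_zigGood hZ₂ s₂).2.2.1] at hO2 hO3
    rw [hfam₁] at hO1 hO3
    have hst1 := famSlot_steep_of_deltaSteep L₁ e₃ hZ₁.1
    rw [hfam₁] at hst1
    have hrow₂ := hrow_of L₂ σ₂ (-e₃) hztn hZ₂
    obtain ⟨step₁', hsel₁', hmain⟩ := barlow_zigRow_hlines_oriented_apart hsE hcert hDS hCP hσ₁' hσ₂ L₁' L₂ s₁ s₂ hax₁ hst1 hrow₂
      hO1 (fun F hF => apart_upFrame L₁ e₃ (hO2 F hF)) hO3 R₀ hR₀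
    obtain ⟨step₁, hsel₁, hpt₁⟩ := htr₁ step₁' hsel₁'
    refine ⟨step₁, stepZ₂, hsel₁, hselZ₂, ?_⟩
    intro h hh ρ hρ X P₁ P₂ hX hP₁X hP₂X hcyl hP₁ hP₂
    have hP₁' : ∀ p, p ∈ P₁ ↔ (p ∈ stacking L₁' s₁ σ₁' ∧ -(2 * R₀) ≤ p 2 ∧ p 2 ≤ -R₀ ∧ p 0 ^ 2 + p 1 ^ 2 ≤ ρ ^ 2) := by
      intro p; rw [hst₁]; exact hP₁ p
    obtain ⟨m, T₁, T₄, hm0, hT₁, hT₄, hcount⟩ := hmain h hh ρ hρ X P₁ P₂ hX hP₁X hP₂X hcyl hP₁' hP₂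
    obtain ⟨T₂, hT₂⟩ := zigSup₂ h ρ m X P₂ hm0 hρ hP₂
    obtain ⟨T₃, hT₃⟩ := rowSup₁ h ρ m X P₁ hm0 hρ hP₁
    refine ⟨m, T₁, T₂, T₃, T₄, hm0, fun t ⟨k, hk⟩ => hT₁ t ⟨k, ?_⟩, hT₂, hT₃, fun kj hc hi => hT₄ kj ⟨hc, hi⟩, ?_⟩
    · rw [← hpt₁ k t]; exact hk
    · simp only [zigW, rowW, if_pos hZ₁, if_neg hZ₂]
      have h0 : (0 : ℝ) ≤ T₂.card := Nat.cast_nonneg _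
      have h0' : (0 : ℝ) ≤ T₃.card := Nat.cast_nonneg _
      linarith
  · -- ROW | ZIG
    rw [(corner_of_not_zigGood hZ₁ s₁).2.2.1] at hO1 hO3
    rw [(corner_of_zigGood hZ₂ s₂).2.2.1] at hO2 hO3
    rw [hfam₂] at hO2 hO3
    have hst2 := famSlot_steep_of_deltaSteep L₂ (-e₃) hZ₂.1
    rw [hfam₂] at hst2
    have hrow₁ := hrow_of L₁ σ₁ e₃ he₃n hZ₁
    obtain ⟨step₂', hsel₂', hmain⟩ := barlow_rowZig_hlines_oriented_apart hsE hcert hDS hCP hσ₁ hσ₂' L₁ L₂' s₁ s₂ hrow₁ hax₂ hst2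
      (fun F hF => apart_upFrame L₂ (-e₃) (hO1 F hF)) hO2 hO3 R₀ hR₀
    obtain ⟨step₂, hsel₂, hpt₂⟩ := htr₂ step₂' hsel₂'
    refine ⟨stepZ₁, step₂, hselZ₁, hsel₂, ?_⟩
    intro h hh ρ hρ X P₁ P₂ hX hP₁X hP₂X hcyl hP₁ hP₂
    have hP₂' : ∀ p, p ∈ P₂ ↔ (p ∈ stacking L₂' s₂ σ₂' ∧ h + R₀ ≤ p 2 ∧ p 2 ≤ h + 2 * R₀ ∧ p 0 ^ 2 + p 1 ^ 2 ≤ ρ ^ 2) := by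
      intro p; rw [hst₂]; exact hP₂ p
    obtain ⟨m, T₃, T₂, hm0, hT₃, hT₂, hcount⟩ := hmain h hh ρ hρ X P₁ P₂ hX hP₁X hP₂X hcyl hP₁ hP₂'
    obtain ⟨T₁, hT₁⟩ := zigSup₁ h ρ m X P₁ hm0 hρ hP₁
    obtain ⟨T₄, hT₄⟩ := rowSup₂ h ρ m X P₂ hm0 hρ hP₂
    refine ⟨m, T₁, T₂, T₃, T₄, hm0, hT₁, fun t ⟨k, hk⟩ => hT₂ t ⟨k, ?_⟩, fun kj hc hi => hT₃ kj ⟨hc, hi⟩, hT₄, ?_⟩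
    · rw [← hpt₂ k t]; exact hk
    · simp only [zigW, rowW, if_neg hZ₁, if_pos hZ₂]
      have h0 : (0 : ℝ) ≤ T₁.card := Nat.cast_nonneg _
      have h0' : (0 : ℝ) ≤ T₄.card := Nat.cast_nonneg _
      linarith
  · -- ROW | ROW
    rw [(corner_of_not_zigGood hZ₁ s₁).2.2.1] at hO1 hO3
    rw [(corner_of_not_zigGood hZ₂ s₂).2.2.1] at hO2 hO3
    have hrow₁ := hrow_of L₁ σ₁ e₃ he₃n hZ₁
    have hrow₂ := hrow_of L₂ σ₂ (-e₃) hztn hZ₂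
    have hmain := barlow_rowRow_hlines_apart hsE hcert hDS hCP hσ₁ hσ₂ L₁ L₂ s₁ s₂ hrow₁ hrow₂ hO1 hO2 hO3 R₀ hR₀
    refine ⟨stepZ₁, stepZ₂, hselZ₁, hselZ₂, ?_⟩
    intro h hh ρ hρ X P₁ P₂ hX hP₁X hP₂X hcyl hP₁ hP₂
    obtain ⟨m, T₃, T₄, hm0, hT₃, hT₄, hcount⟩ := hmain h hh ρ hρ X P₁ P₂ hX hP₁X hP₂X hcyl hP₁ hP₂
    obtain ⟨T₁, hT₁⟩ := zigSup₁ h ρ m X P₁ hm0 hρ hP₁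
    obtain ⟨T₂, hT₂⟩ := zigSup₂ h ρ m X P₂ hm0 hρ hP₂
    refine ⟨m, T₁, T₂, T₃, T₄, hm0, hT₁, hT₂, fun kj hc hi => hT₃ kj ⟨hc, hi⟩, fun kj hc hi => hT₄ kj ⟨hc, hi⟩, ?_⟩
    simp only [zigW, rowW, if_neg hZ₁, if_neg hZ₂]
    have h0 : (0 : ℝ) ≤ T₁.card := Nat.cast_nonneg _
    have h0' : (0 : ℝ) ≤ T₂.card := Nat.cast_nonneg _
    linarith

/-- **Lane T's row-covered part from thickness `6` for `OffR := FramesApart`** — the stub `stub_bilayerWallRowCov : ∃ R,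
BilayerWallRowCovFrom FramesApart R` of `TexShadow` v6.13 closes as `⟨6, bilayerWallRowCovFrom_framesApart hsE hcert hDS hCP⟩`, modulo E1
(`hsE`, `hcert`) and the `StarPairFar` facts (`hDS`, `hCP`): `bilayerWallRowCovFrom_of_lineCounts` fed with `barlow_rowhlines_apart`. -/
theorem bilayerWallRowCovFrom_framesApart
    {sE : EuclideanSpace ℝ (Fin 3)} (hsE : sE ∈ fccSlots) (hcert : ExactOnly 0 (fccSlots.filter fun w => 0 < ⟪w, sE⟫_ℝ))
    (hDS : ∀ F₁ F₂ : EuclideanSpace ℝ (Fin 3) ≃ₗᵢ[ℝ] EuclideanSpace ℝ (Fin 3), DoubleStarCoaxialAt F₁ F₂) (hCP : CapPairCoaxial) :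
    BilayerWallRowCovFrom FramesApart 6 :=
  bilayerWallRowCovFrom_of_lineCounts FramesApart 6 (by norm_num) fun R₀ hR₀ =>
    ⟨540 + 384 * R₀, fun _ _ hσ₁ hσ₂ L₁ L₂ s₁ s₂ hoff => barlow_rowhlines_apart hsE hcert hDS hCP R₀ hR₀ hσ₁ hσ₂ L₁ L₂ s₁ s₂ hoff⟩

/-- **The row-covered stub's statement**: `∃ R, BilayerWallRowCovFrom FramesApart R` (modulo E1 and `StarPairFar`). -/
theorem exists_bilayerWallRowCovFrom_framesApart
    {sE : EuclideanSpace ℝ (Fin 3)} (hsE : sE ∈ fccSlots) (hcert : ExactOnly 0 (fccSlots.filter fun w => 0 < ⟪w, sE⟫_ℝ))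
    (hDS : ∀ F₁ F₂ : EuclideanSpace ℝ (Fin 3) ≃ₗᵢ[ℝ] EuclideanSpace ℝ (Fin 3), DoubleStarCoaxialAt F₁ F₂) (hCP : CapPairCoaxial) :
    ∃ R : ℝ, BilayerWallRowCovFrom FramesApart R :=
  ⟨6, bilayerWallRowCovFrom_framesApart hsE hcert hDS hCP⟩

end Summit.Ventures.Crystal3D.Theorems

end
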